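import Summits.QuantumFields.BalabanUV.Beta.GAN24.DerivativeRateTransferJensenMassFreePoincare

/-!
# `BalabanUV.Beta.GAN24.DerivativeRateTransferLoewnerGramMassLattice` — binder row G-an2-4 ∕ (CONV-C), route R6 «VALUES, NOT DERIVATIVES», PART 97:
# THE `G`-MASS LETTERS ON THE BLOCK LATTICE — the reference field of a transported block-mean source (`Q r = e_{(y₀,a₀)}`, `|r|² = L^d`), the carrier bound
# `|Qv|² ≤ (L^d)⁻¹|v|²`, and the crude covariant-Laplacian ceiling `Σ_e|R_e u(tgt e) − u(src e)|² ≤ 4d·|u|²` (so `⟨r,H_fr⟩ ≤ 4d·w_f′·L^d` for any fine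
# form below `w_f′·` the covariant Laplacian): three of the four lattice letters PART 95's `hN` reduction consumes, explicit in `(d, L, w_c, w_f′)`
# (unit b2b-balaban-gan24-p3, gen 48; v1)

NOT IN PRINT; OUR PROOF (for the ROUTE; [folklore] — PART 21's weighted Jensen `dotProduct_self_wsum_le`, PART 24's block weights `sum_blockWeight`, PART 24's
`chain_injective` (the fine translation is a bijection) BY NAME).  HONEST FRAMING (cell contract, verbatim): «discharging `BetaPertH` makes Bałaban's UV
stability UNCONDITIONAL — a real constructive-QFT result; it is NOT the continuum limit and NOT the Clay problem.»  HONEST DEPENDENCY (verbatim): «continuum YM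
on T⁴ ⇐ BetaPertH ∧ nine spine estimates (0/9 proved); BetaPertH ⇐ (D1) ∧ (D4) ∧ CAP+tail; G-an2-4 gates asym, D1 and NE2/3/4.»

WHY THIS FILE.  PART 95 (`…LoewnerGramMass.abs_gram_minOp_le_of_coercive`) turns the END's Gram letter `hN` into four LATTICE LETTERS per level: a coercivity
constant `γ` on `ker Q` (PART 93 `coercive_lattice`: `γ = (L^d)⁻¹w_f∕(4(d(L−1))²)` on the block lattice), and, for every unit-lattice source `(y₀,a₀)`, a
REFERENCE FIELD `r` with `Q r = e_{(y₀,a₀)}`, its mass `ρ` and energy `E`, plus the carrier bound `g`.  This file supplies the last three on the block lattice of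
PARTs 24 ∕ 64 ∕ 85 ∕ 93 (coarse sites `Fin d → ZMod M`, fine sites `(Fin d → ZMod M) × (Fin d → Fin L)`, colour `o`, comb ∕ any orthogonal block transporters
`W y x`, averaging `(Qu)(y) = Σ_x q_{yx}·W_{yx}u(x)`, `q_{yx} = (L^d)⁻¹·[x ∈ block y]`):
 * the reference field is the TRANSPORTED BLOCK INDICATOR `r(x,·) = [x ∈ block y₀]·W_{y₀x}ᵀe_{a₀}` — `Q r = e_{(y₀,a₀)}` (`W Wᵀ = 1`), `|r|² = L^d`;
 * the carrier bound is block Jensen: `|Qv|² ≤ (L^d)⁻¹|v|²`, so `⟨v,(w_c d′)•QᵀQ v⟩ ≤ w_c d′(L^d)⁻¹|v|²` and `(w_c d′)•QᵀQ` is PSD;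
 * the energy letter is CRUDE and background-free: for orthogonal bond transporters `Σ_e|R_e u(tgt e) − u(src e)|² ≤ 4d|u|²` (each site is the source of `d`
   and the target of `d` bonds; the fine translation is a bijection), hence `⟨r,H_fr⟩ ≤ w_f′·4d·L^d` for every fine form with `⟨u,H_fu⟩ ≤ w_f′·Σ_e|…|²`
   (an UPPER comparability — the lattice PARTs so far carried only the lower one, which is what coercivity wants).
With PART 93's `γ` the one-step Gram letter is then the FORMULA `N = w_c d′(L^d)⁻¹·(4(B + 4d w_f′L^d)·4(d(L−1))²(L^d)∕w_f + 2L^d)` — (H2)-free, explicit in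
`(d, L, w_c, w_f, w_f′, B)`; its composition with PART 95 is one `exact` once PARTs 93 ∕ 95 are built (staged as PART 98).

WHAT THIS FILE PROVES (0 sorry, 0 `def`, nothing cited):
* §1 `mulVec_transpose_self_of_orthogonal` (`W(Wᵀe) = e`), **`mulVec_Q_blockRef`** (`Q r = e_{(y₀,a₀)}`), **`dotProduct_self_blockRef`** (`|r|² = L^d·|e_{a₀}|² = L^d`).
* §2 **`dotProduct_self_Q_le`** (`|Qv|² ≤ (L^d)⁻¹|v|²`), `form_blockGram_le` (`⟨v,(c•QᵀQ)v⟩ ≤ c(L^d)⁻¹|v|²`, `0 ≤ c`), `posSemidef_blockGram`.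
* §3 **`sum_bondDiff_sq_le_four_d_mass`** (`Σ_e|R_e u(tgt e) − u(src e)|² ≤ 4d|u|²`), **`form_blockRef_le`** (`⟨r,H_fr⟩ ≤ w_f′·(4d·L^d)`).
WHAT IT DOES NOT DO: re-index the letters along a tower (ON-REQUEST item (b)); sharpen `E` to the surface order `L^{d−1}` (the comb makes `r` covariantly constant
along comb bonds — not used); supply `γ` (PART 93) or compose (PART 98, staged).  SUPPLIER work on route C-R6° (rank 2, REDUCTION); no consumer of record; NEVER
«G-an2-4 closed»; NOT (CONV-C), NOT D1, NOT `BetaPertH`, NOT continuum, NOT Clay.  Records: `HOME/b2b-balaban-gan24-p3/gen48/R6-LEDGER-NOTE.md`, `…/gen48/README.md`.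
-/

noncomputable section

open Matrix Finset Function

namespace Summit.QuantumFields.BalabanUV.Beta.GAN24.DerivativeRateTransferLoewnerGramMassLattice

open Summit.QuantumFields.BalabanUV.Beta.GAN24.DerivativeRateTransferLoewnerKKT (mulVec_dotProduct_eq)
open Summit.QuantumFields.BalabanUV.Beta.GAN24.DerivativeRateTransferJensenChain (self_of_orthogonal mul_transpose_of_orthogonal
  dotProduct_self_wsum_le dotProduct_self_nonneg')
open Summit.QuantumFields.BalabanUV.Beta.GAN24.DerivativeRateTransferJensen (dotProduct_self_eq_sum_sites)
open Summit.QuantumFields.BalabanUV.Beta.GAN24.DerivativeRateTransferJensenLattice (sum_blockWeight blockWeight_nonneg chain_injective)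

variable {d L M : ℕ} {o : Type*} [Fintype o] [DecidableEq o]

/-! ## §1 The reference field of a transported block-mean source -/

section Reference

omit [Fintype o] in
/-- `WᵀW = 1 ⟹ W(Wᵀe) = e`. [folklore] -/
theorem mulVec_transpose_self_of_orthogonal [Fintype o] {W : Matrix o o ℝ} (hW : Wᵀ * W = 1) (e : o → ℝ) : W *ᵥ (Wᵀ *ᵥ e) = e := by
  rw [mulVec_mulVec, mul_transpose_of_orthogonal hW, one_mulVec]

variable [NeZero M] [NeZero L]

/-- **`mulVec_Q_blockRef` — THE TRANSPORTED BLOCK INDICATOR IS A REFERENCE FIELD**: for orthogonal block transporters `W` and the transported block averaging `Q`,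
the fine field `r(x,·) = [x ∈ block y₀]·W_{y₀x}ᵀ e_{a₀}` has `Q r = e_{(y₀,a₀)}`. [our proof] -/
theorem mulVec_Q_blockRef {W : (Fin d → ZMod M) → (Fin d → ZMod M) × (Fin d → Fin L) → Matrix o o ℝ} (hW : ∀ y x, (W y x)ᵀ * W y x = 1)
    {Q : Matrix ((Fin d → ZMod M) × o) (((Fin d → ZMod M) × (Fin d → Fin L)) × o) ℝ}
    (hQ : ∀ (u : ((Fin d → ZMod M) × (Fin d → Fin L)) × o → ℝ) (y : Fin d → ZMod M),
      (fun a => (Q *ᵥ u) (y, a)) = ∑ x, (if x.1 = y then ((L : ℝ) ^ d)⁻¹ else 0) • (W y x *ᵥ fun b => u (x, b)))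
    (y₀ : Fin d → ZMod M) (a₀ : o) :
    Q *ᵥ (fun p : ((Fin d → ZMod M) × (Fin d → Fin L)) × o =>
        if p.1.1 = y₀ then ((W y₀ p.1)ᵀ *ᵥ Pi.single a₀ (1 : ℝ)) p.2 else 0) = Pi.single (y₀, a₀) 1 := by
  funext p
  obtain ⟨y, a⟩ := p
  have h := congrFun (hQ (fun p : ((Fin d → ZMod M) × (Fin d → Fin L)) × o =>
    if p.1.1 = y₀ then ((W y₀ p.1)ᵀ *ᵥ Pi.single a₀ (1 : ℝ)) p.2 else 0) y) a
  simp only at h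
  rw [h]
  by_cases hy : y = y₀
  · subst hy
    -- inside the block the transported field is `e_{a₀}`, outside the weight vanishes
    have hterm : ∀ x : (Fin d → ZMod M) × (Fin d → Fin L),
        (if x.1 = y then ((L : ℝ) ^ d)⁻¹ else 0) • (W y x *ᵥ fun b => if x.1 = y then ((W y x)ᵀ *ᵥ Pi.single a₀ (1 : ℝ)) b else 0) =
          (if x.1 = y then ((L : ℝ) ^ d)⁻¹ else 0) • (Pi.single a₀ (1 : ℝ) : o → ℝ) := fun x => by
      by_cases hx : x.1 = y
      · simp only [hx, if_true]
        rw [show (fun b => ((W y x)ᵀ *ᵥ Pi.single a₀ (1 : ℝ)) b) = (W y x)ᵀ *ᵥ Pi.single a₀ 1 from rfl,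
          mulVec_transpose_self_of_orthogonal (hW y x)]
      · simp only [hx, if_false, zero_smul]
    rw [Finset.sum_congr rfl fun x _ => hterm x, ← Finset.sum_smul, sum_blockWeight, one_smul]
    simp [Pi.single_apply]
  · have hterm : ∀ x : (Fin d → ZMod M) × (Fin d → Fin L),
        (if x.1 = y then ((L : ℝ) ^ d)⁻¹ else 0) • (W y x *ᵥ fun b => if x.1 = y₀ then ((W y₀ x)ᵀ *ᵥ Pi.single a₀ (1 : ℝ)) b else 0) = 0 := fun x => by
      by_cases hx : x.1 = y
      · have hx0 : ¬ x.1 = y₀ := fun h' => hy (hx.symm.trans h')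
        simp only [hx0, if_false]
        rw [show (fun _ : o => (0 : ℝ)) = (0 : o → ℝ) from rfl, mulVec_zero, smul_zero]
      · simp only [hx, if_false, zero_smul]
    rw [Finset.sum_congr rfl fun x _ => hterm x, Finset.sum_const_zero]
    have : ((y, a) : (Fin d → ZMod M) × o) ≠ (y₀, a₀) := fun h' => hy (congrArg Prod.fst h')
    simp [this]

/-- **`dotProduct_self_blockRef` — ITS MASS IS THE BLOCK VOLUME**: `|r|² = L^d`. [our proof] -/
theorem dotProduct_self_blockRef {W : (Fin d → ZMod M) → (Fin d → ZMod M) × (Fin d → Fin L) → Matrix o o ℝ} (hW : ∀ y x, (W y x)ᵀ * W y x = 1)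
    (y₀ : Fin d → ZMod M) (a₀ : o) :
    (fun p : ((Fin d → ZMod M) × (Fin d → Fin L)) × o => if p.1.1 = y₀ then ((W y₀ p.1)ᵀ *ᵥ Pi.single a₀ (1 : ℝ)) p.2 else 0) ⬝ᵥ
      (fun p : ((Fin d → ZMod M) × (Fin d → Fin L)) × o => if p.1.1 = y₀ then ((W y₀ p.1)ᵀ *ᵥ Pi.single a₀ (1 : ℝ)) p.2 else 0) = (L : ℝ) ^ d := by
  rw [dotProduct_self_eq_sum_sites]
  have hsite : ∀ x : (Fin d → ZMod M) × (Fin d → Fin L),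
      ((fun b => if x.1 = y₀ then ((W y₀ x)ᵀ *ᵥ Pi.single a₀ (1 : ℝ)) b else 0) ⬝ᵥ
        fun b => if x.1 = y₀ then ((W y₀ x)ᵀ *ᵥ Pi.single a₀ (1 : ℝ)) b else 0) =
      (L : ℝ) ^ d * (if x.1 = y₀ then ((L : ℝ) ^ d)⁻¹ else 0) := fun x => by
    by_cases hx : x.1 = y₀
    · simp only [hx, if_true]
      have hWt : ((W y₀ x)ᵀ)ᵀ * (W y₀ x)ᵀ = 1 := by rw [transpose_transpose]; exact mul_transpose_of_orthogonal (hW y₀ x)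
      rw [show (fun b => ((W y₀ x)ᵀ *ᵥ Pi.single a₀ (1 : ℝ)) b) = (W y₀ x)ᵀ *ᵥ Pi.single a₀ 1 from rfl, self_of_orthogonal hWt]
      have hL : ((L : ℝ) ^ d) ≠ 0 := pow_ne_zero _ (Nat.cast_ne_zero.mpr (NeZero.ne L))
      rw [mul_inv_cancel₀ hL]
      simp
    · simp only [hx, if_false, mul_zero]
      simp [dotProduct]
  simp_rw [hsite]
  rw [← Finset.mul_sum, sum_blockWeight, mul_one]

end Reference

/-! ## §2 The carrier bound: block Jensen for transported means -/

section Carrier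

variable [NeZero M] [NeZero L]

/-- **`dotProduct_self_Q_le` — BLOCK JENSEN**: for orthogonal block transporters, `|Qv|² ≤ (L^d)⁻¹·|v|²`. [our proof] -/
theorem dotProduct_self_Q_le {W : (Fin d → ZMod M) → (Fin d → ZMod M) × (Fin d → Fin L) → Matrix o o ℝ} (hW : ∀ y x, (W y x)ᵀ * W y x = 1)
    {Q : Matrix ((Fin d → ZMod M) × o) (((Fin d → ZMod M) × (Fin d → Fin L)) × o) ℝ}
    (hQ : ∀ (u : ((Fin d → ZMod M) × (Fin d → Fin L)) × o → ℝ) (y : Fin d → ZMod M),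
      (fun a => (Q *ᵥ u) (y, a)) = ∑ x, (if x.1 = y then ((L : ℝ) ^ d)⁻¹ else 0) • (W y x *ᵥ fun b => u (x, b)))
    (v : ((Fin d → ZMod M) × (Fin d → Fin L)) × o → ℝ) :
    (Q *ᵥ v) ⬝ᵥ (Q *ᵥ v) ≤ ((L : ℝ) ^ d)⁻¹ * (v ⬝ᵥ v) := by
  rw [dotProduct_self_eq_sum_sites (Q *ᵥ v), dotProduct_self_eq_sum_sites v, Finset.mul_sum]
  -- blockwise Jensen
  have hy : ∀ y : Fin d → ZMod M, (fun a => (Q *ᵥ v) (y, a)) ⬝ᵥ (fun a => (Q *ᵥ v) (y, a)) ≤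
      ∑ x, (if x.1 = y then ((L : ℝ) ^ d)⁻¹ else 0) * ((fun b => v (x, b)) ⬝ᵥ fun b => v (x, b)) := fun y => by
    rw [hQ v y]
    exact dotProduct_self_wsum_le Finset.univ (fun x _ => blockWeight_nonneg y x) (sum_blockWeight (L := L) (M := M) y).le
      (fun x _ => hW y x) fun x b => v (x, b)
  refine (Finset.sum_le_sum fun y _ => hy y).trans (le_of_eq ?_)
  rw [Finset.sum_comm]
  refine Finset.sum_congr rfl fun x _ => ?_
  rw [← Finset.sum_mul, Finset.sum_ite_eq Finset.univ x.1]
  simp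

omit [DecidableEq o] in
/-- `⟨v, QᵀQ v⟩ = |Qv|²`. [folklore] -/
theorem form_gram_eq {μ ν : Type*} [Fintype μ] [Fintype ν] (Q : Matrix μ ν ℝ) (v : ν → ℝ) : v ⬝ᵥ ((Qᵀ * Q) *ᵥ v) = (Q *ᵥ v) ⬝ᵥ (Q *ᵥ v) := by
  rw [← mulVec_mulVec, ← mulVec_dotProduct_eq]

/-- **`form_blockGram_le` — THE CARRIER BOUND**: `⟨v, (c•QᵀQ)v⟩ ≤ c·(L^d)⁻¹·|v|²` for `0 ≤ c` (`c = w_c·d′` for PART 56's carrier). [our proof] -/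
theorem form_blockGram_le {W : (Fin d → ZMod M) → (Fin d → ZMod M) × (Fin d → Fin L) → Matrix o o ℝ} (hW : ∀ y x, (W y x)ᵀ * W y x = 1)
    {Q : Matrix ((Fin d → ZMod M) × o) (((Fin d → ZMod M) × (Fin d → Fin L)) × o) ℝ}
    (hQ : ∀ (u : ((Fin d → ZMod M) × (Fin d → Fin L)) × o → ℝ) (y : Fin d → ZMod M),
      (fun a => (Q *ᵥ u) (y, a)) = ∑ x, (if x.1 = y then ((L : ℝ) ^ d)⁻¹ else 0) • (W y x *ᵥ fun b => u (x, b)))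
    {c : ℝ} (hc : 0 ≤ c) (v : ((Fin d → ZMod M) × (Fin d → Fin L)) × o → ℝ) :
    v ⬝ᵥ ((c • (Qᵀ * Q)) *ᵥ v) ≤ c * ((L : ℝ) ^ d)⁻¹ * (v ⬝ᵥ v) := by
  rw [smul_mulVec, dotProduct_smul, smul_eq_mul, form_gram_eq, mul_assoc]
  exact mul_le_mul_of_nonneg_left (dotProduct_self_Q_le hW hQ v) hc

omit [DecidableEq o] [NeZero M] [NeZero L] in
/-- the scaled Gram carrier `c•QᵀQ` is PSD for `0 ≤ c`. [folklore] -/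
theorem posSemidef_blockGram {μ ν : Type*} [Fintype μ] [Fintype ν] (Q : Matrix μ ν ℝ) {c : ℝ} (hc : 0 ≤ c) : (c • (Qᵀ * Q)).PosSemidef := by
  have h := Matrix.posSemidef_conjTranspose_mul_self Q
  rw [Matrix.conjTranspose_eq_transpose_of_trivial] at h
  exact h.smul hc

end Carrier

/-! ## §3 The crude energy letter: the covariant Laplacian form is bounded by `4d` times the mass -/

section Energy

variable [NeZero M]

/-- **`sum_bondDiff_sq_le_four_d_mass` — THE CRUDE CEILING OF THE COVARIANT LAPLACIAN FORM**: orthogonal bond transporters `R_e` on the block lattice ⟹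
`Σ_e|R_e u(tgt e) − u(src e)|² ≤ 4d·|u|²` (`|a − b|² ≤ 2|a|² + 2|b|²`; every site is the source of `d` bonds and — the fine translation being a bijection — the
target of `d` bonds). [our proof] -/
theorem sum_bondDiff_sq_le_four_d_mass (hL : 0 < L) {R : ((Fin d → ZMod M) × (Fin d → Fin L)) × Fin d → Matrix o o ℝ} (hR : ∀ e, (R e)ᵀ * R e = 1)
    (u : ((Fin d → ZMod M) × (Fin d → Fin L)) × o → ℝ) :
    ∑ e : ((Fin d → ZMod M) × (Fin d → Fin L)) × Fin d,
        ((R e *ᵥ fun b => u ((e.1.1 + ((((e.1.2 e.2 : ℕ) + 1) / L) • (Pi.single e.2 (1 : ZMod M))),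
            update e.1.2 e.2 ⟨((e.1.2 e.2 : ℕ) + 1) % L, Nat.mod_lt _ hL⟩), b)) - fun b => u (e.1, b)) ⬝ᵥ
          ((R e *ᵥ fun b => u ((e.1.1 + ((((e.1.2 e.2 : ℕ) + 1) / L) • (Pi.single e.2 (1 : ZMod M))),
            update e.1.2 e.2 ⟨((e.1.2 e.2 : ℕ) + 1) % L, Nat.mod_lt _ hL⟩), b)) - fun b => u (e.1, b)) ≤ 4 * d * (u ⬝ᵥ u) := by
  haveI : NeZero L := ⟨hL.ne'⟩
  -- site masses
  set m : (Fin d → ZMod M) × (Fin d → Fin L) → ℝ := fun x => (fun b => u (x, b)) ⬝ᵥ fun b => u (x, b) with hm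
  have hm0 : ∀ x, 0 ≤ m x := fun x => dotProduct_self_nonneg' _
  -- bondwise: `|R a − b|² ≤ 2|a|² + 2|b|²`
  have hbond : ∀ e : ((Fin d → ZMod M) × (Fin d → Fin L)) × Fin d,
      ((R e *ᵥ fun b => u ((e.1.1 + ((((e.1.2 e.2 : ℕ) + 1) / L) • (Pi.single e.2 (1 : ZMod M))),
          update e.1.2 e.2 ⟨((e.1.2 e.2 : ℕ) + 1) % L, Nat.mod_lt _ hL⟩), b)) - fun b => u (e.1, b)) ⬝ᵥ
        ((R e *ᵥ fun b => u ((e.1.1 + ((((e.1.2 e.2 : ℕ) + 1) / L) • (Pi.single e.2 (1 : ZMod M))),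
          update e.1.2 e.2 ⟨((e.1.2 e.2 : ℕ) + 1) % L, Nat.mod_lt _ hL⟩), b)) - fun b => u (e.1, b)) ≤
      2 * m ((e.1.1 + ((((e.1.2 e.2 : ℕ) + 1) / L) • (Pi.single e.2 (1 : ZMod M))),
          update e.1.2 e.2 ⟨((e.1.2 e.2 : ℕ) + 1) % L, Nat.mod_lt _ hL⟩)) + 2 * m e.1 := fun e => by
    set a : o → ℝ := R e *ᵥ fun b => u ((e.1.1 + ((((e.1.2 e.2 : ℕ) + 1) / L) • (Pi.single e.2 (1 : ZMod M))),
      update e.1.2 e.2 ⟨((e.1.2 e.2 : ℕ) + 1) % L, Nat.mod_lt _ hL⟩), b) with ha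
    set b' : o → ℝ := fun b => u (e.1, b) with hb
    have haa : a ⬝ᵥ a = m ((e.1.1 + ((((e.1.2 e.2 : ℕ) + 1) / L) • (Pi.single e.2 (1 : ZMod M))),
        update e.1.2 e.2 ⟨((e.1.2 e.2 : ℕ) + 1) % L, Nat.mod_lt _ hL⟩)) := by rw [ha, self_of_orthogonal (hR e)]
    have h0 : 0 ≤ (a + b') ⬝ᵥ (a + b') := dotProduct_self_nonneg' _
    simp only [dotProduct_add, add_dotProduct] at h0
    simp only [dotProduct_sub, sub_dotProduct]
    have hc : a ⬝ᵥ b' = b' ⬝ᵥ a := dotProduct_comm a b'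
    rw [← haa]
    linarith
  refine (Finset.sum_le_sum fun e _ => hbond e).trans ?_
  rw [Finset.sum_add_distrib, ← Finset.mul_sum, ← Finset.mul_sum]
  -- sources: each site `d` times
  have hsrc : ∑ e : ((Fin d → ZMod M) × (Fin d → Fin L)) × Fin d, m e.1 = d * ∑ x, m x := by
    rw [Fintype.sum_prod_type, Finset.sum_comm]
    simp only [Finset.sum_const, Finset.card_univ, Fintype.card_fin, nsmul_eq_mul, Finset.mul_sum]
  -- targets: the fine translation in direction `μ` is a bijection
  have htgt : ∑ e : ((Fin d → ZMod M) × (Fin d → Fin L)) × Fin d,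
      m ((e.1.1 + ((((e.1.2 e.2 : ℕ) + 1) / L) • (Pi.single e.2 (1 : ZMod M))),
          update e.1.2 e.2 ⟨((e.1.2 e.2 : ℕ) + 1) % L, Nat.mod_lt _ hL⟩)) = d * ∑ x, m x := by
    have hμ : ∀ μ : Fin d, ∑ x : (Fin d → ZMod M) × (Fin d → Fin L),
        m ((x.1 + ((((x.2 μ : ℕ) + 1) / L) • (Pi.single μ (1 : ZMod M))), update x.2 μ ⟨((x.2 μ : ℕ) + 1) % L, Nat.mod_lt _ hL⟩)) =
        ∑ x, m x := fun μ => by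
      have hbij := Finite.injective_iff_bijective.mp (chain_injective (M := M) hL μ 1)
      exact Equiv.sum_comp (Equiv.ofBijective _ hbij) m
    rw [Fintype.sum_prod_type_right, Finset.sum_congr rfl fun μ _ => hμ μ]
    simp only [Finset.sum_const, Finset.card_univ, Fintype.card_fin, nsmul_eq_mul]
  rw [hsrc, htgt, dotProduct_self_eq_sum_sites u]
  have hS : 0 ≤ ∑ x, m x := Finset.sum_nonneg fun x _ => hm0 x
  nlinarith

variable [NeZero L]

/-- **`form_blockRef_le` — THE ENERGY LETTER OF THE REFERENCE FIELD**: a fine form with the UPPER comparability `⟨u,H_fu⟩ ≤ w_f′·Σ_e|R_e u(tgt e) − u(src e)|²`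
(`0 ≤ w_f′`), orthogonal `R`, `W` ⟹ `⟨r, H_f r⟩ ≤ w_f′·(4d·L^d)` for the transported block indicator `r` of §1. [our proof] -/
theorem form_blockRef_le (hL : 0 < L) {R : ((Fin d → ZMod M) × (Fin d → Fin L)) × Fin d → Matrix o o ℝ} (hR : ∀ e, (R e)ᵀ * R e = 1)
    {W : (Fin d → ZMod M) → (Fin d → ZMod M) × (Fin d → Fin L) → Matrix o o ℝ} (hW : ∀ y x, (W y x)ᵀ * W y x = 1)
    {Hf : Matrix (((Fin d → ZMod M) × (Fin d → Fin L)) × o) (((Fin d → ZMod M) × (Fin d → Fin L)) × o) ℝ} {wf' : ℝ} (hwf' : 0 ≤ wf')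
    (hHf' : ∀ u : ((Fin d → ZMod M) × (Fin d → Fin L)) × o → ℝ, u ⬝ᵥ (Hf *ᵥ u) ≤
      wf' * ∑ e : ((Fin d → ZMod M) × (Fin d → Fin L)) × Fin d,
        ((R e *ᵥ fun b => u ((e.1.1 + ((((e.1.2 e.2 : ℕ) + 1) / L) • (Pi.single e.2 (1 : ZMod M))),
            update e.1.2 e.2 ⟨((e.1.2 e.2 : ℕ) + 1) % L, Nat.mod_lt _ hL⟩), b)) - fun b => u (e.1, b)) ⬝ᵥ
          ((R e *ᵥ fun b => u ((e.1.1 + ((((e.1.2 e.2 : ℕ) + 1) / L) • (Pi.single e.2 (1 : ZMod M))),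
            update e.1.2 e.2 ⟨((e.1.2 e.2 : ℕ) + 1) % L, Nat.mod_lt _ hL⟩), b)) - fun b => u (e.1, b)))
    (y₀ : Fin d → ZMod M) (a₀ : o) :
    (fun p : ((Fin d → ZMod M) × (Fin d → Fin L)) × o => if p.1.1 = y₀ then ((W y₀ p.1)ᵀ *ᵥ Pi.single a₀ (1 : ℝ)) p.2 else 0) ⬝ᵥ
      (Hf *ᵥ fun p : ((Fin d → ZMod M) × (Fin d → Fin L)) × o => if p.1.1 = y₀ then ((W y₀ p.1)ᵀ *ᵥ Pi.single a₀ (1 : ℝ)) p.2 else 0) ≤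
      wf' * (4 * d * (L : ℝ) ^ d) := by
  refine (hHf' _).trans (mul_le_mul_of_nonneg_left ?_ hwf')
  have h := sum_bondDiff_sq_le_four_d_mass (M := M) hL hR
    (fun p : ((Fin d → ZMod M) × (Fin d → Fin L)) × o => if p.1.1 = y₀ then ((W y₀ p.1)ᵀ *ᵥ Pi.single a₀ (1 : ℝ)) p.2 else 0)
  rw [dotProduct_self_blockRef hW y₀ a₀] at h
  exact h

end Energy

end Summit.QuantumFields.BalabanUV.Beta.GAN24.DerivativeRateTransferLoewnerGramMassLattice

end
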